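import Mathlib
import Summits.AtomisticToContinuum.FouriersLaw.Theses.OddSectorIrreversibility
import Literature.MathematicalPhysics.KineticTheory.OddSectorLocalityHypothesis
import Literature.Barriers.AtomisticToContinuum.MazurBoundBallisticOpenChain
import Literature.MathematicalPhysics.KineticTheory.LangevinChainGibbs

/-!
# Crux `ConeScaleCorrector` (stmt-AtomisticToContinuum-14069) — ideator 3 sketch (round 1)

First lemmas (as `Prop`s over existing declarations) for the crux idea cards
* `local-equilibrium-gauge`  : `LocalEquilibriumGauge`, `LEDefectBound`, `GaugeEquivalence`,
  `EnergyPairing`, `ProfileDefectSummable`, `Halving` (+ `ParityMoment`, `OddConeForecast`,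
  `FirstMomentLower`);
* `hydro-projection-absorption` : `ConeTransportBudget` (C1 of the promote seat, restated),
  `HydroExitLaw`, `PhaseContraction`, `L2Contraction`, `AbsorptionGlue`.
Nothing is proved here; everything must elaborate.
-/

noncomputable section

open MeasureTheory Set Filter Topology
open Literature.MathematicalPhysics.KineticTheory.HeatConduction
open Literature.MathematicalPhysics.KineticTheory.OddSectorLocality
open Summit.AtomisticToContinuum.FouriersLaw.Theses.OddSectorIrreversibility

namespace Summit.AtomisticToContinuum.FouriersLaw.Cruxes.ConeScaleCorrector.Ideator3

section Objects

variable (ω₂ lam β γ T : ℝ) (N : ℕ)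

/-- Mass `Z = ∫ e^{-H/T}` of the unnormalised Gibbs weight (verbatim the crux's right-hand factor). -/
def Zmass : ℝ :=
  ∫ x, Real.exp (-((pinnedChain ω₂ lam β γ).hamiltonian N x) / T) ∂(volume : Measure (PhaseSpace N))

/-- `u` is an a.e.-limit of the finite-horizon Kubo correctors `∫₀^τ P_tJ_tot dt` (equilibrium OPEN
kernels) — verbatim the antecedent of `ConeScaleCorrector`, through `currentForecast`. -/
def IsCorrector (u : PhaseSpace N → ℝ) : Prop :=
  ∀ᵐ x ∂(gibbsWeight ω₂ lam β γ T N),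
    Tendsto (fun τ : ℝ => ∫ t in Ioc (0:ℝ) τ, currentForecast ω₂ lam β γ T N t x) atTop (𝓝 (u x))

/-- Site energy `e_k = p_k²/2 + U(q_k) + ½V(q_{k+1}-q_k) + ½V(q_k-q_{k-1})` (bond energies split
evenly, as in `OpenChain.energyMoment`). -/
def siteEnergy (k : Fin N) (x : PhaseSpace N) : ℝ :=
  x.2 k ^ 2 / 2 + (pinnedChain ω₂ lam β γ).U (x.1 k) +
    ∑ l : Fin N,
      ((if l.val = k.val + 1 then (pinnedChain ω₂ lam β γ).V (x.1 l - x.1 k) / 2 else 0) +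
        (if k.val = l.val + 1 then (pinnedChain ω₂ lam β γ).V (x.1 k - x.1 l) / 2 else 0))

/-- Centred energy dipole `X_c = X - ((N-1)/2)·H`, `X = ∑_k k e_k` the tree's `energyMoment`. -/
def dipoleC (x : PhaseSpace N) : ℝ :=
  Literature.Barriers.AtomisticToContinuum.OpenChain.energyMoment (pinnedChain ω₂ lam β γ) N x -
    (((N : ℝ) - 1) / 2) * (pinnedChain ω₂ lam β γ).hamiltonian N x

/-- The LOCAL-EQUILIBRIUM response density `h^{LE} = -(X_c - ⟨X_c⟩_π)/((N-1)T²)`: the `δ`-derivative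
at `δ = 0` of the local Gibbs density with the linear inverse-temperature profile
`1/T_k = 1/(T + δ(½ - k/(N-1)))`. -/
def hLE (π : Measure (PhaseSpace N)) (x : PhaseSpace N) : ℝ :=
  -(dipoleC ω₂ lam β γ N x - ∫ y, dipoleC ω₂ lam β γ N y ∂π) / (((N : ℝ) - 1) * T ^ 2)

/-- Local copy of the route's response-density predicate (`ResponseDensity` / `OddDensityIsCorrector`):
`h ∈ L²(μ_{N,T,T})` is the weak `δ`-derivative of `δ ↦ μ_{N,T+δ/2,T-δ/2}` on `C_c^∞` observables and on
the bond currents. -/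
def IsResponseDensity (μ : (N : ℕ) → ℝ → ℝ → Measure (PhaseSpace N)) (h : PhaseSpace N → ℝ) : Prop :=
  MemLp h 2 (μ N T T) ∧
  (∀ F : PhaseSpace N → ℝ, ContDiff ℝ ((⊤ : ℕ∞) : WithTop ℕ∞) F → HasCompactSupport F →
    Tendsto (fun δ : ℝ => ((∫ x, F x ∂(μ N (T + δ / 2) (T - δ / 2))) - ∫ x, F x ∂(μ N T T)) / δ)
      (𝓝[≠] 0) (𝓝 (∫ x, F x * h x ∂(μ N T T)))) ∧
  (∀ i : Fin N, Tendsto (fun δ : ℝ =>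
      ((∫ x, (pinnedChain ω₂ lam β γ).bondCurrent N i x ∂(μ N (T + δ / 2) (T - δ / 2))) -
        ∫ x, (pinnedChain ω₂ lam β γ).bondCurrent N i x ∂(μ N T T)) / δ)
      (𝓝[≠] 0) (𝓝 (∫ x, (pinnedChain ω₂ lam β γ).bondCurrent N i x * h x ∂(μ N T T))))

/-- The first moment `M₁(N) = ∫₀^∞ t·⟨J, P_tJ⟩_{L²(μ_T)} dt` of the open-chain current autocorrelation
(`currentAutocorr`, unnormalised). -/
def firstMoment : ℝ := ∫ t in Ioi (0:ℝ), t * currentAutocorr ω₂ lam β γ T N t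

/-- The site-energy PROFILE map and the σ-algebra it generates. -/
def energyProfile (x : PhaseSpace N) : Fin N → ℝ := fun k => siteEnergy ω₂ lam β γ N k x

/-- σ-algebra of the energy profile. -/
@[reducible] def profileSigma : MeasurableSpace (PhaseSpace N) :=
  MeasurableSpace.comap (energyProfile ω₂ lam β γ N) inferInstance

/-- HYDRO PART of an observable: its conditional expectation given the site-energy profile under the
Gibbs weight (finite measure; `μ[f|m]` of Mathlib). For `Θ`-odd `f` it vanishes (π and the profile are
`Θ`-even). -/
def hydroPart (f : PhaseSpace N → ℝ) : PhaseSpace N → ℝ :=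
  MeasureTheory.condExp (profileSigma ω₂ lam β γ N) (gibbsWeight ω₂ lam β γ T N) f

/-- The forecast `P_s g (x) = ∫ g dP_s(x,·)` under the equilibrium OPEN kernels. -/
def forecast (s : ℝ) (g : PhaseSpace N → ℝ) (x : PhaseSpace N) : ℝ :=
  ∫ y, g y ∂((pinnedChain ω₂ lam β γ).transitionKernel N T T s.toNNReal x)

end Objects

/-- Weak-NESS uniqueness (the route's `NessUnique` at one parameter point). -/
def NessUniq (ω₂ lam β γ : ℝ) : Prop :=
  ∀ (N : ℕ) (T_L T_R : ℝ), 0 < T_L → 0 < T_R → ∀ μ ν : Measure (PhaseSpace N),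
    (pinnedChain ω₂ lam β γ).IsSteadyState N T_L T_R μ →
      (pinnedChain ω₂ lam β γ).IsSteadyState N T_L T_R ν → μ = ν

/-- A steady-state family. -/
def IsFamily (ω₂ lam β γ : ℝ) (μ : (N : ℕ) → ℝ → ℝ → Measure (PhaseSpace N)) : Prop :=
  ∀ (N : ℕ) (T_L T_R : ℝ), 0 < T_L → 0 < T_R → (pinnedChain ω₂ lam β γ).IsSteadyState N T_L T_R (μ N T_L T_R)

/-! ## Card 1 — `local-equilibrium-gauge` -/

/-- **(G) Local-equilibrium gauge identity (FIRST LEMMA, fixed `N`).** The EVEN companion of the route's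
`OddDensityIsCorrector`: with `h` the response density and `u` the Kubo corrector,
`h = h^{LE} - (u∘Θ)/((N-1)T²)` a.e. — McLennan's boundary-driven form of the first-order NESS equals
Zubarev's gradient-driven (local-equilibrium × bulk entropy production) form; derivation:
`L†h = (w_L - w_R)/(2T²)`, `L†h^{LE} = (-A+S)(-X̃_c)/((N-1)T²) = J/((N-1)T²) + (w_L-w_R)/(2T²)`
(`A X_c = J` = `poisson_hamiltonian_energyMoment`, `S X_c = ((N-1)/2)(w_R - w_L)`), hence
`L†(h - h^{LE}) = -J/((N-1)T²)` and `h - h^{LE} = Θ L⁻¹ J/((N-1)T²) = -(u∘Θ)/((N-1)T²)`. -/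
def LocalEquilibriumGauge : Prop :=
  ∀ ω₂ lam β γ : ℝ, 0 < ω₂ → 0 < lam → 0 < β → 0 < γ → NessUniq ω₂ lam β γ →
    ∀ μ : (N : ℕ) → ℝ → ℝ → Measure (PhaseSpace N), IsFamily ω₂ lam β γ μ →
      ∀ T : ℝ, 0 < T → ∀ (N : ℕ) (h u : PhaseSpace N → ℝ), 2 ≤ N →
        IsResponseDensity ω₂ lam β γ T N μ h → IsCorrector ω₂ lam β γ T N u →
          MemLp u 2 (gibbsWeight ω₂ lam β γ T N) →
            ∀ᵐ x ∂(μ N T T),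
              h x = hLE ω₂ lam β γ T N (μ N T T) x - u (x.1, -x.2) / (((N : ℝ) - 1) * T ^ 2)

/-- **(LE-L²) Static form of E1: the linear-response NESS is `O(1)`-close to local equilibrium in
`L²(μ_{N,T,T})`, uniformly in `N`.** -/
def LEDefectBound : Prop :=
  ∀ ω₂ lam β γ : ℝ, 0 < ω₂ → 0 < lam → 0 < β → 0 < γ → NessUniq ω₂ lam β γ →
    ∀ μ : (N : ℕ) → ℝ → ℝ → Measure (PhaseSpace N), IsFamily ω₂ lam β γ μ →
      ∀ T : ℝ, 0 < T → ∃ C : ℝ, ∀ (N : ℕ) (h : PhaseSpace N → ℝ), 2 ≤ N →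
        IsResponseDensity ω₂ lam β γ T N μ h →
          MemLp (fun x => h x - hLE ω₂ lam β γ T N (μ N T T) x) 2 (μ N T T) ∧
            ∫ x, (h x - hLE ω₂ lam β γ T N (μ N T T) x) ^ 2 ∂(μ N T T) ≤ C

/-- **E1 ⟺ LE-L²** given the route's fixed-`N` supports and (G): `‖u‖²_π = (N-1)²T⁴‖h - h^{LE}‖²_π`. -/
def GaugeEquivalence : Prop :=
  NessUnique → GibbsSteadyState → ResponseDensity → CorrectorTheory → LocalEquilibriumGauge →
    (ConeScaleCorrector ↔ LEDefectBound)

/-- **Energy pairing (fixed `N`, one line from (G)):** the projection of the corrector on a site energy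
is the site's RESPONSE DEFECT: `⟨u, e_k⟩_π = -(N-1)T²·(∂_δ⟨e_k⟩_NESS - ∂_δ⟨e_k⟩_LE)`. -/
def EnergyPairing : Prop :=
  ∀ ω₂ lam β γ : ℝ, 0 < ω₂ → 0 < lam → 0 < β → 0 < γ → NessUniq ω₂ lam β γ →
    ∀ μ : (N : ℕ) → ℝ → ℝ → Measure (PhaseSpace N), IsFamily ω₂ lam β γ μ →
      ∀ T : ℝ, 0 < T → ∀ (N : ℕ) (h u : PhaseSpace N → ℝ) (k : Fin N), 2 ≤ N →
        IsResponseDensity ω₂ lam β γ T N μ h → IsCorrector ω₂ lam β γ T N u →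
          MemLp u 2 (gibbsWeight ω₂ lam β γ T N) →
            ∫ x, u x * siteEnergy ω₂ lam β γ N k x ∂(μ N T T) =
              -(((N : ℝ) - 1) * T ^ 2) *
                ((∫ x, siteEnergy ω₂ lam β γ N k x * h x ∂(μ N T T)) -
                  ∫ x, siteEnergy ω₂ lam β γ N k x * hLE ω₂ lam β γ T N (μ N T T) x ∂(μ N T T))

/-- **Necessary test 1 (cheapest falsifier of E1 from the EVEN side): the linear-response energy
PROFILE defect is square-summable uniformly in `N`** —
`∑_k (∂_δ⟨e_k⟩_NESS - ∂_δ⟨e_k⟩_LE)² ≤ C`, i.e. the temperature profile is linear up to an `ℓ²`-summable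
boundary layer (Kapitza jumps of bounded height and width are allowed; an `O(1)` S-shaped deviation, as
in anomalous chains, or the harmonic FLAT profile (`∑ ≍ N`) are not). -/
def ProfileDefectSummable : Prop :=
  ∀ ω₂ lam β γ : ℝ, 0 < ω₂ → 0 < lam → 0 < β → 0 < γ → NessUniq ω₂ lam β γ →
    ∀ μ : (N : ℕ) → ℝ → ℝ → Measure (PhaseSpace N), IsFamily ω₂ lam β γ μ →
      ∀ T : ℝ, 0 < T → ∃ C : ℝ, ∀ (N : ℕ) (h : PhaseSpace N → ℝ), 2 ≤ N →
        IsResponseDensity ω₂ lam β γ T N μ h →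
          ∑ k : Fin N,
            ((∫ x, siteEnergy ω₂ lam β γ N k x * h x ∂(μ N T T)) -
              ∫ x, siteEnergy ω₂ lam β γ N k x * hLE ω₂ lam β γ T N (μ N T T) x ∂(μ N T T)) ^ 2 ≤ C

/-- Upper frame bound of the centred site energies in `L²(π)`, uniform in `N` (summable decay of
`⟨ẽ_k, ẽ_l⟩_π` for the nearest-neighbour Gibbs measure at `T > 0`; transfer-operator statics). -/
def EnergyFrameBound : Prop :=
  ∀ ω₂ lam β γ : ℝ, 0 < ω₂ → 0 < lam → 0 < β → 0 < γ → ∀ T : ℝ, 0 < T → ∃ Λ : ℝ, ∀ (N : ℕ)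
    (f : PhaseSpace N → ℝ), MemLp f 2 ((pinnedChain ω₂ lam β γ).gibbsMeasure N T) →
      ∑ k : Fin N,
        (∫ x, f x * (siteEnergy ω₂ lam β γ N k x -
          ∫ y, siteEnergy ω₂ lam β γ N k y ∂((pinnedChain ω₂ lam β γ).gibbsMeasure N T))
            ∂((pinnedChain ω₂ lam β γ).gibbsMeasure N T)) ^ 2 ≤
        Λ * ∫ x, (f x) ^ 2 ∂((pinnedChain ω₂ lam β γ).gibbsMeasure N T)

/-- Test 1 is NECESSARY for E1 (Bessel/frame inequality applied to `f = h - h^{LE}`, mean-zero). -/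
def ProfileTestNecessary : Prop :=
  NessUnique → GibbsSteadyState → EnergyFrameBound → LEDefectBound → ProfileDefectSummable

/-- `‖u - u∘Θ‖² ≤ C N² Z`: the ODD half of E1 = the route's corrected namesake WSI
(`sup_N ∫(h - h∘Θ)² dπ < ∞` via `OddDensityIsCorrector`). -/
def OddConeForecast : Prop :=
  ∀ ω₂ lam β γ : ℝ, 0 < ω₂ → 0 < lam → 0 < β → 0 < γ → ∀ T : ℝ, 0 < T → ∃ C : ℝ, ∀ (N : ℕ)
    (u : PhaseSpace N → ℝ), IsCorrector ω₂ lam β γ T N u → MemLp u 2 (gibbsWeight ω₂ lam β γ T N) →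
      ∫ x, (u x - u (x.1, -x.2)) ^ 2 ∂(gibbsWeight ω₂ lam β γ T N) ≤
        C * (N : ℝ) ^ 2 * Zmass ω₂ lam β γ T N

/-- One-sided first-moment (Einstein–Helfand intercept) bound: `-M₁(N) ≤ C N² Z`. Heuristically
`|M₁| = O(N^{3/2})` (bulk `t^{-3/2}` current tails) + `O(N)` (contact/hydrodynamic tail). -/
def FirstMomentLower : Prop :=
  ∀ ω₂ lam β γ : ℝ, 0 < ω₂ → 0 < lam → 0 < β → 0 < γ → ∀ T : ℝ, 0 < T → ∃ C : ℝ, ∀ N : ℕ,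
    -(C * (N : ℝ) ^ 2 * Zmass ω₂ lam β γ T N) ≤ firstMoment ω₂ lam β γ T N

/-- The replica–parity–moment identity of crux 9140 (ideator 2), restated: `⟨u, u∘Θ⟩_{μ_T} = -M₁(N)`
(fixed `N`; Θ-detailed balance + Fubini). -/
def ParityMoment : Prop :=
  ∀ ω₂ lam β γ : ℝ, 0 < ω₂ → 0 < lam → 0 < β → 0 < γ → ∀ T : ℝ, 0 < T → ∀ (N : ℕ)
    (u : PhaseSpace N → ℝ), IsCorrector ω₂ lam β γ T N u → MemLp u 2 (gibbsWeight ω₂ lam β γ T N) →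
      ∫ x, u x * u (x.1, -x.2) ∂(gibbsWeight ω₂ lam β γ T N) = -firstMoment ω₂ lam β γ T N

/-- **Halving:** `‖u‖² = ½‖u - u∘Θ‖² - M₁` hence `E1 ⟺ WSI ∧ FirstMomentLower`. -/
def Halving : Prop :=
  CorrectorTheory → ParityMoment → (ConeScaleCorrector ↔ (OddConeForecast ∧ FirstMomentLower))

/-! ## Card 2 — `hydro-projection-absorption` -/

/-- **C1 (promote seat's `ConeTransportBudget`, restated): Einstein–Helfand envelope of the finite-horizon
corrector**, `‖u_τ‖²_{μ_T} ≤ C·N·(1+τ)·Z`. -/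
def ConeTransportBudget : Prop :=
  ∀ ω₂ lam β γ : ℝ, 0 < ω₂ → 0 < lam → 0 < β → 0 < γ → ∀ T : ℝ, 0 < T → ∃ C : ℝ, ∀ (N : ℕ) (τ : ℝ),
    0 ≤ τ →
      ∫ x, (∫ t in Ioc (0:ℝ) τ, currentForecast ω₂ lam β γ T N t x) ^ 2 ∂(gibbsWeight ω₂ lam β γ T N) ≤
        C * (N : ℝ) * (1 + τ) * Zmass ω₂ lam β γ T N

/-- **`L²(μ_T)`-contraction of the equilibrium kernels** (Gibbs invariance + Jensen; dictionary (1) of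
`OddSectorLocalityHypothesis`). -/
def L2Contraction : Prop :=
  ∀ ω₂ lam β γ : ℝ, 0 < ω₂ → 0 < lam → 0 < β → 0 < γ → ∀ T : ℝ, 0 < T → ∀ (N : ℕ) (s : ℝ)
    (g : PhaseSpace N → ℝ), 0 ≤ s → MemLp g 2 (gibbsWeight ω₂ lam β γ T N) →
      MemLp (forecast ω₂ lam β γ T N s g) 2 (gibbsWeight ω₂ lam β γ T N) ∧
        ∫ x, (forecast ω₂ lam β γ T N s g x) ^ 2 ∂(gibbsWeight ω₂ lam β γ T N) ≤
          ∫ x, (g x) ^ 2 ∂(gibbsWeight ω₂ lam β γ T N)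

/-- **(H) Hydro exit law: the profile-forecast of the corrector is at the cone scale**,
`‖E[u | e_0,…,e_{N-1}]‖²_{μ_T} ≤ C N² Z` — equivalently (gauge) the heat release predicted from the
energy profile alone follows the DIPOLE LAW `E[v_R | e] = -X̃/(N-1) + O(1)` (gambler's ruin for energy,
with `O(1)` resistance-fluctuation corrections). Only the EVEN part of `u` contributes. -/
def HydroExitLaw : Prop :=
  ∀ ω₂ lam β γ : ℝ, 0 < ω₂ → 0 < lam → 0 < β → 0 < γ → ∀ T : ℝ, 0 < T → ∃ C : ℝ, ∀ (N : ℕ)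
    (u : PhaseSpace N → ℝ), IsCorrector ω₂ lam β γ T N u → MemLp u 2 (gibbsWeight ω₂ lam β γ T N) →
      ∫ x, (hydroPart ω₂ lam β γ T N u x) ^ 2 ∂(gibbsWeight ω₂ lam β γ T N) ≤
        C * (N : ℝ) ^ 2 * Zmass ω₂ lam β γ T N

/-- **(P) Phase contraction over one causal crossing (scale-free):** the phase part
`g := u - E[u | e]` of the corrector loses a FIXED fraction of its `L²(μ_T)`-norm under `P_{aN}`:
`‖P_{aN} g‖ ≤ θ‖g‖`, `θ < 1`, uniformly in `N`. -/
def PhaseContraction : Prop :=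
  ∀ ω₂ lam β γ : ℝ, 0 < ω₂ → 0 < lam → 0 < β → 0 < γ → ∀ T : ℝ, 0 < T → ∃ a θ : ℝ, 0 < a ∧ 0 ≤ θ ∧
    θ < 1 ∧ ∀ (N : ℕ) (u : PhaseSpace N → ℝ), IsCorrector ω₂ lam β γ T N u →
      MemLp u 2 (gibbsWeight ω₂ lam β γ T N) →
        ∫ x, (forecast ω₂ lam β γ T N (a * N) (fun y => u y - hydroPart ω₂ lam β γ T N u y) x) ^ 2
            ∂(gibbsWeight ω₂ lam β γ T N) ≤
          θ ^ 2 * ∫ x, (u x - hydroPart ω₂ lam β γ T N u x) ^ 2 ∂(gibbsWeight ω₂ lam β γ T N)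

/-- **Absorption glue:** `u = u_{aN} + P_{aN}E[u|e] + P_{aN}(u - E[u|e])` (Chapman–Kolmogorov from
`CorrectorTheory`), `‖P_{aN}E[u|e]‖ ≤ ‖E[u|e]‖` (`L2Contraction`), `‖P_{aN}g‖ ≤ θ‖g‖ ≤ θ‖u‖`
(`g ⊥` profile-measurable functions), so `(1-θ)‖u‖ ≤ ‖u_{aN}‖ + ‖E[u|e]‖` and
`‖u‖² ≤ 2(C₁N(1+aN) + C_H N²)Z/(1-θ)²`. -/
def AbsorptionGlue : Prop :=
  CorrectorTheory → L2Contraction → ConeTransportBudget → HydroExitLaw → PhaseContraction →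
    ConeScaleCorrector

/-- The elementary absorption inequality behind the glue (real numbers). -/
theorem absorb {x a b θ : ℝ} (hθ : θ < 1) (h : x ≤ a + b + θ * x) : x ≤ (a + b) / (1 - θ) := by
  rw [le_div_iff₀ (by linarith)]
  nlinarith

end Summit.AtomisticToContinuum.FouriersLaw.Cruxes.ConeScaleCorrector.Ideator3
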